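import Mathlib
import Literature.NumberTheory.Transcendental.KZCalculus
import Literature.NumberTheory.Transcendental.SemialgebraicMapsProofs
import Literature.NumberTheory.Transcendental.KZProductIdeal
import HarnessLib

/-!
# Stub `stub_productCoV` — crux `TorsionLogs.NeronTorsionSector`, line `registered` (block S4)

Kontsevich–Zagier's rule (2) (change of variables, `KZ.changeOfVariablesRel`) for a **product map
of the plane** `Φ(x, x′) = (φ(x), x′)`: if `φ` is `ℚ`-semialgebraic and injective on `A ⊆ ℝ` with a
derivative `φ′(x)` at every `x ∈ A`, `S ⊆ A × ℝ`, and two plane representations satisfy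
`r.domain = S`, `r′.domain = Φ(S)`, `r.integrand = (r′.integrand ∘ Φ) · |φ′|` on `S`, then
`[r] − [r′] ∈ KZ.relations`. The witness of the move is `Φ` with the diagonal derivative
`Φ′(x, x′) = diag(φ′(x), 1)` (`Matrix.toLin'` of `Matrix.diagonal ![φ′ x, 1]`), whose determinant is
`φ′(x)`; `Φ` is a `ℚ`-semialgebraic map because its two coordinates are (`φ ∘ pr₀` through the
cylinder lemma `KZ.isSemialgebraicFunOn_cylinder_left`, `pr₁` a polynomial), and it is injective on `S`
because `φ` is injective on `A`.

References: M. Kontsevich, D. Zagier, *Periods* (2001), §1.2 rule (2); J. Bochnak, M. Coste,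
M.-F. Roy, *Real Algebraic Geometry* (1998), §2.2.
-/

noncomputable section

-- `Summit.KontsevichZagierPeriods.KontsevichZagierPeriods.…` is the tree's mandated layout (single-conjunct summit).
set_option linter.dupNamespace false

open Set MeasureTheory MvPolynomial
open Literature.NumberTheory.Transcendental Literature.ModelTheory.ExponentialFields

namespace Summit.KontsevichZagierPeriods.KontsevichZagierPeriods.Cruxes.NeronTorsionSector.Translation

/-- **The diagonal linear map `diag(a, 1)` of the plane acts coordinatewise**:
`diag(a, 1) v = (a v₀, v₁)`. [folklore] -/
theorem productMapDeriv_apply (a : ℝ) (v : Fin 2 → ℝ) :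
    (LinearMap.toContinuousLinearMap (Matrix.toLin' (Matrix.diagonal ![a, 1])) :
      (Fin 2 → ℝ) →L[ℝ] (Fin 2 → ℝ)) v = fun i => ![a, 1] i * v i := by
  ext i
  simp [Matrix.mulVec_diagonal]

/-- **The determinant of `diag(a, 1)` is `a`.** [folklore] -/
theorem det_productMapDeriv (a : ℝ) :
    (LinearMap.toContinuousLinearMap (Matrix.toLin' (Matrix.diagonal ![a, 1])) :
      (Fin 2 → ℝ) →L[ℝ] (Fin 2 → ℝ)).det = a := by
  simp [LinearMap.det_toLin', Matrix.det_diagonal]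

/-- **Derivative of the product map `Φ(x, x′) = (φ(x), x′)`.** If `φ` has derivative `a` at `z₀`, then
`z ↦ (φ(z₀), z₁)` has at `z` the diagonal derivative `diag(a, 1)` (chain rule through the coordinate
projections, `hasFDerivAt_pi''`). [folklore] -/
theorem hasFDerivAt_productMap {φ : ℝ → ℝ} {a : ℝ} {z : Fin 2 → ℝ} (hφ : HasDerivAt φ a (z 0)) :
    HasFDerivAt (fun w : Fin 2 → ℝ => (![φ (w 0), w 1] : Fin 2 → ℝ))
      (LinearMap.toContinuousLinearMap (Matrix.toLin' (Matrix.diagonal ![a, 1]))) z := by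
  refine hasFDerivAt_pi'' (Fin.forall_fin_two.mpr ⟨?_, ?_⟩)
  · have h1 := hφ.comp_hasFDerivAt z (hasFDerivAt_apply (𝕜 := ℝ) 0 z)
    have he : (ContinuousLinearMap.proj 0).comp
        (LinearMap.toContinuousLinearMap (Matrix.toLin' (Matrix.diagonal ![a, 1])) :
          (Fin 2 → ℝ) →L[ℝ] (Fin 2 → ℝ)) =
        a • (ContinuousLinearMap.proj 0 : (Fin 2 → ℝ) →L[ℝ] ℝ) := by
      ext v
      simp [productMapDeriv_apply]
    rw [he]
    simpa [Function.comp_def] using h1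
  · have he : (ContinuousLinearMap.proj 1).comp
        (LinearMap.toContinuousLinearMap (Matrix.toLin' (Matrix.diagonal ![a, 1])) :
          (Fin 2 → ℝ) →L[ℝ] (Fin 2 → ℝ)) =
        (ContinuousLinearMap.proj 1 : (Fin 2 → ℝ) →L[ℝ] ℝ) := by
      ext v
      simp [productMapDeriv_apply]
    rw [he]
    simpa using hasFDerivAt_apply (𝕜 := ℝ) 1 z

/-- **`φ ∘ pr₀` is `ℚ`-semialgebraic on every `ℚ`-semialgebraic `S ⊆ A × ℝ`** when `φ` is
`ℚ`-semialgebraic on `A` (as a function of one variable): the cylinder lemma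
`KZ.isSemialgebraicFunOn_cylinder_left` over `A × ℝ`, restricted to `S`.
[cite: BochnakCosteRoy1998, §2.2] -/
theorem isSemialgebraicFunOn_comp_apply_zero {φ : ℝ → ℝ} {A : Set ℝ} {S : Set (Fin 2 → ℝ)}
    (hA : IsSemialgebraic ℚ {t : Fin 1 → ℝ | t 0 ∈ A})
    (hφ : IsSemialgebraicFunOn ℚ {t : Fin 1 → ℝ | t 0 ∈ A} (fun t => φ (t 0)))
    (hS : IsSemialgebraic ℚ S) (hSA : S ⊆ {z | z 0 ∈ A}) :
    IsSemialgebraicFunOn ℚ S (fun z : Fin 2 → ℝ => φ (z 0)) := by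
  have hcyl := KZ.isSemialgebraicFunOn_cylinder_left (l := 1) (d := 1)
    (G := fun t : Fin 1 → ℝ => φ (t 0)) hA isSemialgebraic_univ hφ
  have hsub : S ⊆ {z : Fin (1 + 1) → ℝ |
      (fun i => z (Fin.castAdd 1 i)) ∈ {t : Fin 1 → ℝ | t 0 ∈ A} ∧
        (fun j => z (Fin.natAdd 1 j)) ∈ (univ : Set (Fin 1 → ℝ))} :=
    fun z hz => ⟨hSA hz, mem_univ _⟩
  exact (hcyl.mono hsub hS).congr fun z _ => rfl

/-- **STUB S4 (`stub_productCoV`) — rule (2) for a product map `Φ(x, x′) = (φ(x), x′)`.** If `φ` is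
`ℚ`-semialgebraic and injective on `A` with a derivative `φ′` at every point of `A`, `S ⊆ A × ℝ`, and
two plane representations satisfy `r.domain = S`, `r′.domain = Φ(S)`,
`r.integrand = (r′.integrand ∘ Φ)·|φ′|` on `S`, then `[r] − [r′] ∈ KZ.relations`: one move of
`KZ.changeOfVariablesRel` with `Φ′ = diag(φ′(x), 1)` (`hasFDerivAt_productMap`,
`det_productMapDeriv`), `IsSemialgebraicMapOn.of_forall` for the semialgebraicity of `Φ`.
[cite: KontsevichZagier2001, §1.2 rule (2)] -/
theorem stub_productCoV :
    ∀ (φ φ' : ℝ → ℝ) (A : Set ℝ) (S : Set (Fin 2 → ℝ))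
      (r r' : Literature.NumberTheory.Transcendental.KZ.IntegralRep 2),
    IsSemialgebraic ℚ {t : Fin 1 → ℝ | t 0 ∈ A} →
    IsSemialgebraicFunOn ℚ {t : Fin 1 → ℝ | t 0 ∈ A} (fun t => φ (t 0)) →
    Set.InjOn φ A → (∀ x ∈ A, HasDerivAt φ (φ' x) x) →
    S ⊆ {z | z 0 ∈ A} → r.domain = S →
    r'.domain = (fun z : Fin 2 → ℝ => (![φ (z 0), z 1] : Fin 2 → ℝ)) '' S →
    (∀ z ∈ S, r.integrand z = r'.integrand ![φ (z 0), z 1] * |φ' (z 0)|) →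
    Literature.NumberTheory.Transcendental.KZ.of r - Literature.NumberTheory.Transcendental.KZ.of r' ∈
      Literature.NumberTheory.Transcendental.KZ.relations := by
  intro φ φ' A S r r' hA hφ hinj hder hSA hrS hr' hint
  subst hrS
  refine KZ.changeOfVariablesRel_subset_relations
    ⟨2, r, r', fun z => ![φ (z 0), z 1],
      fun z => LinearMap.toContinuousLinearMap (Matrix.toLin' (Matrix.diagonal ![φ' (z 0), 1])),
      ?_, ?_, ?_, hr', ?_, rfl⟩
  · -- `Φ` is a `ℚ`-semialgebraic map: both coordinates are `ℚ`-semialgebraic functions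
    refine IsSemialgebraicMapOn.of_forall r.isSemialgebraic_domain (Fin.forall_fin_two.mpr ⟨?_, ?_⟩)
    · simpa using isSemialgebraicFunOn_comp_apply_zero hA hφ r.isSemialgebraic_domain hSA
    · simpa using isSemialgebraicFunOn_aeval r.isSemialgebraic_domain (X 1 : MvPolynomial (Fin 2) ℚ)
  · -- derivative within the domain
    intro z hz
    exact (hasFDerivAt_productMap (hder (z 0) (hSA hz))).hasFDerivWithinAt
  · -- injective on the domain
    intro z hz z' hz' h
    have h0 := congr_fun h 0
    have h1 := congr_fun h 1
    simp only [Matrix.cons_val_zero, Matrix.cons_val_one] at h0 h1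
    exact funext (Fin.forall_fin_two.mpr ⟨hinj (hSA hz) (hSA hz') h0, h1⟩)
  · -- the Jacobian factor
    intro z hz
    rw [hint z hz, det_productMapDeriv]

end Summit.KontsevichZagierPeriods.KontsevichZagierPeriods.Cruxes.NeronTorsionSector.Translation

end
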